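import Mathlib
import HarnessLib
import Summits.NavierStokesRegularity.NavierStokesRegularity.Theorems.LocalSineTubeDoorGenericDoor
import Summits.NavierStokesRegularity.NavierStokesRegularity.Theorems.LocalSineTubeDoorEnstrophyProductionProfileRigidity

/-!
# The one-window door family — THE ENSTROPHY-PRODUCTION DOOR (unconditional): at a locally Type-I singularity the
# vortex-stretching rate `ω·Sω` cannot fade on any similarity window

Cell ns-regularity-ideate, seat p6 (route-directed support for nsreg-p1's door family; anchor
`--supports stmt-NavierStokesRegularity-20017`; rung N0-LocalTubeDoorSine neighbourhood).  The generic first-order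
template `…LocalSineTubeDoorGenericDoor.genericDoor_of_profileRigidity` with the scalar
`F(x, A) = |⟪curlCLM A, A (curlCLM A)⟫|` — the ENSTROPHY PRODUCTION `ω·(ω·∇)u = ω·Sω` (the antisymmetric part of `∇u`
drops out), `ω = curl u` — whose profile crux is the THEOREM
`…LocalSineTubeDoorEnstrophyProductionProfileRigidity.productionWindowRigidity` (production-free Type-I profiles are
trivial: `|ω|²` is a bounded sub-solution of the drift–diffusion inequality, whole-space maximum principle, decay as
`t → −∞`).  Result (`localTubeDoorEnstrophyProduction`):

  for a classical Leray–Hopf solution on `[0,T)` from rapidly decaying data that is LOCALLY Type I at `(x₀,T)`, if the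
  scale-normalised enstrophy production fades in `L¹` over ONE nonempty open similarity window,
  `∫_U (T−t)³ |(ω·Sω)(t, x₀ + √(T−t)y)| dy → 0` as `t → T⁻`, then `u` stays bounded near `x₀` up to `T`.

(`(T−t)³` is the scale-invariant normalisation: `ω ∼ (T−t)^{-1}`, `S ∼ (T−t)^{-1}`.)  This contains the stretching door
(`…StretchingDoor.localTubeDoorStretching`: `(ω·∇)u` fading ⇒ `ω·Sω` fading) and is the door-family form of the
classical heuristics on DEPLETION OF ENSTROPHY PRODUCTION: under local Type I, depletion of `ω·Sω` to `o((T−t)^{-3})` in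
`L¹` on a single similarity window already rules the singularity out.

* `continuous_productionAbs`, `productionAbs_zeroSet_invariant` — template side conditions;
* `productionSlabRigidityF`, `productionWindowToSlabF` — the crux and window → slab in the template's `F`-form;
* `localTubeDoorEnstrophyProduction` — the door.

WHAT THIS IS NOT: not a claim about Navier–Stokes regularity (Clay A) — a LOCAL regularity CRITERION conditional on
local Type I (bears_on LADDER-NS N0); establishment in the cell's sense needs the cross-family referee PASS +
independent reproduction.
-/

noncomputable section

-- the summit and its single sub-problem share the name (CONVENTIONS §1), as in every Theorems file
set_option linter.dupNamespace false

namespace Summit.NavierStokesRegularity.NavierStokesRegularity.Theorems.LocalSineTubeDoorEnstrophyProductionDoor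

open MeasureTheory Set Function Filter Topology TopologicalSpace Metric
open scoped RealInnerProductSpace InnerProductSpace NNReal ENNReal
open Literature.Analysis Literature.Analysis.FluidPDE
open Summit.NavierStokesRegularity.NavierStokesRegularity.Theorems.LocalSineTubeDoorGenericDoor
open Summit.NavierStokesRegularity.NavierStokesRegularity.Theorems.LocalSineTubeDoorEnstrophyProductionProfileRigidity

/-- The production scalar `F(x, A) = |⟪curlCLM A, A (curlCLM A)⟫|` is continuous in `(x, A)`. -/
theorem continuous_productionAbs :
    Continuous fun q : EuclideanSpace ℝ (Fin 3) × (EuclideanSpace ℝ (Fin 3) →L[ℝ] EuclideanSpace ℝ (Fin 3)) =>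
      |⟪curlCLM q.2, q.2 (curlCLM q.2)⟫_ℝ| := by
  have hω : Continuous fun q : EuclideanSpace ℝ (Fin 3) × (EuclideanSpace ℝ (Fin 3) →L[ℝ] EuclideanSpace ℝ (Fin 3)) =>
      curlCLM q.2 := curlCLM.continuous.comp continuous_snd
  have hS : Continuous fun q : EuclideanSpace ℝ (Fin 3) × (EuclideanSpace ℝ (Fin 3) →L[ℝ] EuclideanSpace ℝ (Fin 3)) =>
      q.2 (curlCLM q.2) := isBoundedBilinearMap_apply.continuous.comp (continuous_snd.prodMk hω)
  exact continuous_abs.comp (hω.inner hS)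

/-- The zero set of `F(x, A) = |⟪curlCLM A, A (curlCLM A)⟫|` is invariant under positive rescalings. -/
theorem productionAbs_zeroSet_invariant :
    ∀ (a b : ℝ), 0 < a → 0 < b → ∀ (x : EuclideanSpace ℝ (Fin 3))
      (A : EuclideanSpace ℝ (Fin 3) →L[ℝ] EuclideanSpace ℝ (Fin 3)),
      |⟪curlCLM (b • A), (b • A) (curlCLM (b • A))⟫_ℝ| = 0 ↔ |⟪curlCLM A, A (curlCLM A)⟫_ℝ| = 0 := by
  intro a b _ hb x A
  rw [map_smul, _root_.smul_apply, map_smul, real_inner_smul_left, real_inner_smul_right, real_inner_smul_right,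
    abs_eq_zero, abs_eq_zero, mul_eq_zero, mul_eq_zero, mul_eq_zero, or_iff_right hb.ne', or_iff_right hb.ne',
    or_iff_right hb.ne']

/-- **The profile SLAB crux of the production door in the template's `F`-form.** -/
theorem productionSlabRigidityF :
    ∀ (C : ℝ) (v : ℝ → EuclideanSpace ℝ (Fin 3) → EuclideanSpace ℝ (Fin 3)),
      Literature.Analysis.FluidPDE.HasTypeITimeDecay C v →
      ContinuousOn (Function.uncurry v) (Set.Iio (0 : ℝ) ×ˢ Set.univ) →
      (∀ s t : ℝ, s < t → t < 0 → ∀ x, v t x =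
        Literature.Analysis.UnboundedOperators.heatExtension (v s) (t - s) x -
          Literature.Analysis.FluidPDE.oseenDuhamel 1 s v v t x) →
      (∀ t < 0, Literature.Analysis.FluidPDE.VectorCalculus.IsDivFree (v t)) →
      (∀ s < 0, ∀ z, (fun (_ : EuclideanSpace ℝ (Fin 3)) (A : EuclideanSpace ℝ (Fin 3) →L[ℝ] EuclideanSpace ℝ (Fin 3)) =>
          |⟪Literature.Analysis.FluidPDE.curlCLM A, A (Literature.Analysis.FluidPDE.curlCLM A)⟫_ℝ|)
          (v s z) (fderiv ℝ (v s) z) = 0) →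
      ¬ Literature.Analysis.FluidPDE.IsBackwardSingularPoint v 0 := by
  intro C v hrate hcont hmild hdiv hslab
  refine not_backwardSingular_of_production_eq_zero hrate hcont hmild hdiv fun s hs y => ?_
  have h := hslab s hs y
  simp only [abs_eq_zero] at h
  rwa [← curl_eq_curlCLM] at h

/-- **Window → slab in the template's `F`-form.** -/
theorem productionWindowToSlabF :
    ∀ (C : ℝ) (v : ℝ → EuclideanSpace ℝ (Fin 3) → EuclideanSpace ℝ (Fin 3)),
      Literature.Analysis.FluidPDE.HasTypeITimeDecay C v →
      ContinuousOn (Function.uncurry v) (Set.Iio (0 : ℝ) ×ˢ Set.univ) →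
      (∀ s t : ℝ, s < t → t < 0 → ∀ x, v t x =
        Literature.Analysis.UnboundedOperators.heatExtension (v s) (t - s) x -
          Literature.Analysis.FluidPDE.oseenDuhamel 1 s v v t x) →
      (∀ t < 0, Literature.Analysis.FluidPDE.VectorCalculus.IsDivFree (v t)) →
      (∀ s < 0, ∃ U : Set (EuclideanSpace ℝ (Fin 3)), IsOpen U ∧ U.Nonempty ∧
        ∀ z ∈ U, (fun (_ : EuclideanSpace ℝ (Fin 3)) (A : EuclideanSpace ℝ (Fin 3) →L[ℝ] EuclideanSpace ℝ (Fin 3)) =>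
          |⟪Literature.Analysis.FluidPDE.curlCLM A, A (Literature.Analysis.FluidPDE.curlCLM A)⟫_ℝ|)
          (v s z) (fderiv ℝ (v s) z) = 0) →
      ∀ s < 0, ∀ z, (fun (_ : EuclideanSpace ℝ (Fin 3)) (A : EuclideanSpace ℝ (Fin 3) →L[ℝ] EuclideanSpace ℝ (Fin 3)) =>
          |⟪Literature.Analysis.FluidPDE.curlCLM A, A (Literature.Analysis.FluidPDE.curlCLM A)⟫_ℝ|)
          (v s z) (fderiv ℝ (v s) z) = 0 := by
  intro C v hrate hcont hmild _ hwin s hs z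
  have hall := productionWindowToSlab hrate hcont hmild (fun s' hs' => by
    obtain ⟨U, hU, hne, hal⟩ := hwin s' hs'
    refine ⟨U, hU, hne, fun y hy => ?_⟩
    have h := hal y hy
    simp only [abs_eq_zero] at h
    rwa [← curl_eq_curlCLM] at h) s hs z
  simp only [abs_eq_zero]
  rwa [← curl_eq_curlCLM]

/-- **THE ENSTROPHY-PRODUCTION DOOR — unconditional.**  A classical Leray–Hopf solution on `[0,T)` from rapidly
decaying data, LOCALLY Type I at `(x₀,T)`, whose scale-normalised enstrophy production `(T−t)³ ⟪ω, Du ω⟫ = (T−t)³ ω·Sω`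
fades in `L¹` over one nonempty open similarity window `x₀ + √(T−t) U` as `t → T⁻`, is backward bounded at `x₀`. -/
theorem localTubeDoorEnstrophyProduction :
    ∀ (ν T : ℝ), 0 < ν → 0 < T → ∀ (u : ℝ → EuclideanSpace ℝ (Fin 3) → EuclideanSpace ℝ (Fin 3))
      (p : ℝ → EuclideanSpace ℝ (Fin 3) → ℝ),
    Literature.Analysis.FluidPDE.IsClassicalNSSolutionOn (Set.Ico 0 T) ν 0 u p →
    Literature.Analysis.FluidPDE.IsLerayHopfOn T ν 0 (u 0) u →
    Literature.Analysis.FluidPDE.HasRapidSpatialDecay (u 0) →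
    ∀ (x₀ : EuclideanSpace ℝ (Fin 3)) (ρ M : ℝ), 0 < ρ →
    (∀ t ∈ Set.Ico 0 T, T - ρ ^ 2 < t → ∀ x ∈ Metric.ball x₀ ρ, ‖u t x‖ * Real.sqrt (ν * (T - t)) ≤ M) →
    ∀ (U : Set (EuclideanSpace ℝ (Fin 3))), IsOpen U → U.Nonempty →
    Filter.Tendsto (fun t => ∫⁻ y in U, ENNReal.ofReal
      ((T - t) ^ 3 * |⟪Literature.Analysis.FluidPDE.curl (u t) (x₀ + Real.sqrt (T - t) • y),
        fderiv ℝ (u t) (x₀ + Real.sqrt (T - t) • y)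
          (Literature.Analysis.FluidPDE.curl (u t) (x₀ + Real.sqrt (T - t) • y))⟫_ℝ|))
      (nhdsWithin T (Set.Iio T)) (nhds 0) →
    Literature.Analysis.FluidPDE.IsBackwardBoundedAt u T x₀ := by
  intro ν T hν hT u p hsol hLH hdec x₀ ρ M hρ hM U hU hUne hfade
  refine genericDoor_of_profileRigidity (fun _ A => |⟪curlCLM A, A (curlCLM A)⟫_ℝ|) continuous_productionAbs
    productionAbs_zeroSet_invariant productionWindowToSlabF productionSlabRigidityF ν T hν hT u p hsol hLH hdec x₀ ρ M
    hρ hM U hU hUne ?_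
  have hev : ∀ᶠ t in nhdsWithin T (Set.Iio T), t < T := eventually_nhdsWithin_of_forall fun t ht => ht
  refine hfade.congr' (hev.mono fun t ht => ?_)
  refine lintegral_congr fun y => ?_
  have hs : 0 ≤ T - t := (sub_pos.2 ht).le
  rw [map_smul, _root_.smul_apply, map_smul, ← curl_eq_curlCLM, real_inner_smul_left, real_inner_smul_right,
    real_inner_smul_right, Real.sq_sqrt hs, abs_abs, abs_mul, abs_mul, abs_mul, abs_of_nonneg hs]
  ring

end Summit.NavierStokesRegularity.NavierStokesRegularity.Theorems.LocalSineTubeDoorEnstrophyProductionDoor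

end
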